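import Mathlib
import Summits.ValiantsHypothesis.ValiantsHypothesis.Theorems.KPlusLogSqLawTridiagonalRealStaticGapProductOneThree
import Summits.ValiantsHypothesis.ValiantsHypothesis.Theorems.KPlusLogSqLawTridiagonalRealStaticRatioTwoLaw

/-!
# The RATIO-THREE FACE LAW of the α register (all sizes): slopes `±g`, `±3g` on non-adjacent links with an occupied midpoint are never sharp

Sequel of `…TridiagonalRealStaticRatioTwoLaw.lean` (this lineage's ENS lane on the static symmetric tridiagonal register of `WeakLifting`,
stmt-ValiantsHypothesis-19561).  Static symmetric tridiagonal monomial design `(a, d, b, f)`, `a_j b_j ≠ 0`, edge slopes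
`L_j = 2f_j − d_j − d_{j+1} ∈ ℤ`, `D_m = pathDet a d b f m`.

* `card_posRoots_add_two_le_of_equal_natAbs` — RATIO ONE is free: two non-adjacent links with `|L_k| = |L_l|` make two matching slope-sums
  coincide (`{k}`/`{l}` or `∅`/`{k,l}`), so `Z(D_m) + 2 ≤ #matchings(P_m)` by the coincidence row.
* **`card_posRoots_add_two_le_card_matchings_of_slopes_g_3g_mid`** — RATIO THREE: if every slope is divisible by `g ≥ 1`, two non-adjacent links
  `k + 2 ≤ l ≤ m − 2` carry slopes of absolute values `g` and `3g`, AND some matching of `P_m` has slope-sum equal to the midpoint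
  `(L_k + L_l)/2` of the face `(∅; k, l)` (e.g. a third link of slope `(L_k + L_l)/2`), then `Z(D_m) + 2 ≤ #matchings(P_m)`: the face values are
  `c, c+g, c+3g, c+4g`, the midpoint `c+2g` is an occupied lattice point INSIDE the span (it multiplies the extremes/middles gap ratio by `4`), and
  with the internal factor `144/36 = 4` the externals would have to compensate a factor `16`, while each side telescopes below `4`
  (`gapProduct_progression_one_three_mid`).  Located: WITHOUT the occupied midpoint the face survives for some designs at every `m ≥ 6`
  (exp/ratio3check.py), so the hypothesis is load-bearing; primitive case `…_of_slopes_one_three_mid`.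

Together with the ratio-two law: a Descartes–Fibonacci sharp design has pairwise distinct `|L|` on non-adjacent links, no non-adjacent pair
`{g, 2g}` on its slope lattice `gℤ`, and no non-adjacent pair `{g, 3g}` with occupied midpoint — the first three rules of a SHARPNESS SIEVE.
HONEST FRAMING: thin all-sizes sector laws; B5 = 7, B6 ∈ [9, 12] and «α NO MOVER» unchanged; nothing on `WeakLifting`/`TropicalB` windows,
Conjecture B, the doors, `MatrixDescartes` (18050) or `VP ≠ VNP`.  Seat: prover val-sym-lift-p2 g18, `--supports stmt-ValiantsHypothesis-19561`.
-/

set_option linter.dupNamespace false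
set_option autoImplicit false

namespace Summit.ValiantsHypothesis.ValiantsHypothesis.Theorems.KPlusLogSqLaw

namespace EdgeNormalForm

open Polynomial Finset
open Summit.ValiantsHypothesis.ValiantsHypothesis.Theorems.KPlusLogSqLaw.StaticTridiagonalRealPotential (pathDet)

variable (a : ℕ → ℝ) (d : ℕ → ℕ) (b : ℕ → ℝ) (f : ℕ → ℕ)

/-! ## 1. Ratio one is a coincidence -/

/-- **equal absolute slopes on two non-adjacent links** give coincident matching slope-sums, hence `Z(D_m) + 2 ≤ #matchings(P_m)`. [this work] -/
theorem card_posRoots_add_two_le_of_equal_natAbs (m k l : ℕ) (hkl : k + 2 ≤ l) (hlm : l + 2 ≤ m)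
    (heq : (2 * (f k : ℤ) - d k - d (k + 1)).natAbs = (2 * (f l : ℤ) - d l - d (l + 1)).natAbs) :
    ((pathDet a d b f m).roots.toFinset.filter (fun x => 0 < x)).card + 2 ≤
      ((range (m - 1)).powerset.filter (fun M : Finset ℕ => ∀ j ∈ M, j + 1 ∉ M)).card := by
  have hkl' : k ≠ l := by omega
  have mk : ({k} : Finset ℕ) ∈ (range (m - 1)).powerset.filter (fun M : Finset ℕ => ∀ j ∈ M, j + 1 ∉ M) := by
    rw [Finset.mem_filter, Finset.mem_powerset, Finset.singleton_subset_iff, Finset.mem_range]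
    refine ⟨by omega, fun j hj hj' => ?_⟩
    rw [Finset.mem_singleton] at hj hj'; omega
  have ml : ({l} : Finset ℕ) ∈ (range (m - 1)).powerset.filter (fun M : Finset ℕ => ∀ j ∈ M, j + 1 ∉ M) := by
    rw [Finset.mem_filter, Finset.mem_powerset, Finset.singleton_subset_iff, Finset.mem_range]
    refine ⟨by omega, fun j hj hj' => ?_⟩
    rw [Finset.mem_singleton] at hj hj'; omega
  have me : (∅ : Finset ℕ) ∈ (range (m - 1)).powerset.filter (fun M : Finset ℕ => ∀ j ∈ M, j + 1 ∉ M) := by simp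
  have mkl : ({k, l} : Finset ℕ) ∈ (range (m - 1)).powerset.filter (fun M : Finset ℕ => ∀ j ∈ M, j + 1 ∉ M) := by
    rw [Finset.mem_filter, Finset.mem_powerset, Finset.insert_subset_iff, Finset.singleton_subset_iff, Finset.mem_range,
      Finset.mem_range]
    refine ⟨⟨by omega, by omega⟩, fun j hj hj' => ?_⟩
    rw [Finset.mem_insert, Finset.mem_singleton] at hj hj'; omega
  rcases Int.natAbs_eq_natAbs_iff.mp heq with h | h
  · exact card_posRoots_add_two_le_of_coincidence a d b f m mk ml (by simp [hkl']) (by simp [h])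
  · refine card_posRoots_add_two_le_of_coincidence a d b f m me mkl (Finset.insert_ne_empty k {l}).symm ?_
    rw [Finset.sum_empty, Finset.sum_pair hkl', h]; ring

/-! ## 2. The ratio-three face law (occupied midpoint) -/

/-- **THE RATIO-THREE FACE LAW (all sizes, lattice form).**  Every slope divisible by `g ≥ 1`; two non-adjacent links `k + 2 ≤ l ≤ m − 2`
with slopes of absolute values `g`, `3g`; some matching of `P_m` with slope-sum `(L_k + L_l)/2` ⇒ `Z(D_m) + 2 ≤ #matchings(P_m)`. [this work] -/
theorem card_posRoots_add_two_le_card_matchings_of_slopes_g_3g_mid (m k l g : ℕ) (ha : ∀ j, a j ≠ 0) (hb : ∀ j, b j ≠ 0)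
    (hg : 1 ≤ g) (hdiv : ∀ j, j + 2 ≤ m → (g : ℤ) ∣ 2 * (f j : ℤ) - d j - d (j + 1))
    (hkl : k + 2 ≤ l) (hlm : l + 2 ≤ m)
    (h13 : ((2 * (f k : ℤ) - d k - d (k + 1)).natAbs = g ∧ (2 * (f l : ℤ) - d l - d (l + 1)).natAbs = 3 * g) ∨
      ((2 * (f k : ℤ) - d k - d (k + 1)).natAbs = 3 * g ∧ (2 * (f l : ℤ) - d l - d (l + 1)).natAbs = g))
    (hmid : ∃ M₀ ∈ (range (m - 1)).powerset.filter (fun M : Finset ℕ => ∀ j ∈ M, j + 1 ∉ M),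
      2 * ∑ j ∈ M₀, (2 * (f j : ℤ) - d j - d (j + 1)) = (2 * (f k : ℤ) - d k - d (k + 1)) + (2 * (f l : ℤ) - d l - d (l + 1))) :
    ((pathDet a d b f m).roots.toFinset.filter (fun x => 0 < x)).card + 2 ≤
      ((range (m - 1)).powerset.filter (fun M : Finset ℕ => ∀ j ∈ M, j + 1 ∉ M)).card := by
  by_contra hcon
  rw [not_le] at hcon
  -- integer slope-sums and the data of `faceRule_of_sharp`
  set zs : Finset ℕ → ℤ := fun M => ∑ j ∈ M, (2 * (f j : ℤ) - d j - d (j + 1)) with hzs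
  set S : Finset (Finset ℕ) := (range (m - 1)).powerset with hSdef
  rw [hSdef] at hcon
  set σ : ↥S → ℝ := fun M => ∑ j ∈ (M : Finset ℕ), (2 * (f j : ℝ) - d j - d (j + 1)) with hσ
  set z : ↥S → ℤ := fun M => zs (M : Finset ℕ) with hz
  have hσz : ∀ M : ↥S, σ M = ((z M : ℤ) : ℝ) := fun M => by simp only [hσ, hz, hzs]; push_cast; rfl
  set Act : Finset ↥S := Finset.univ.filter fun (M : ↥S) => ∀ j ∈ (M : Finset ℕ), j + 1 ∉ (M : Finset ℕ) with hAct
  have hActmap : Act.map (Function.Embedding.subtype _) =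
      (range (m - 1)).powerset.filter (fun M : Finset ℕ => ∀ j ∈ M, j + 1 ∉ M) := by
    ext N
    rw [Finset.mem_map, Finset.mem_filter, Finset.mem_powerset]
    constructor
    · rintro ⟨M, hM, rfl⟩
      exact ⟨Finset.mem_powerset.mp (by rw [← hSdef]; exact M.2), (Finset.mem_filter.mp hM).2⟩
    · rintro ⟨hN, hP⟩
      exact ⟨⟨N, by rw [hSdef]; exact Finset.mem_powerset.mpr hN⟩, Finset.mem_filter.mpr ⟨Finset.mem_univ _, hP⟩, rfl⟩
  have hmemAct : ∀ M : ↥S, M ∈ Act ↔ ∀ j ∈ (M : Finset ℕ), j + 1 ∉ (M : Finset ℕ) := fun M => by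
    simp only [hAct, Finset.mem_filter, Finset.mem_univ, true_and]
  have hcardAct : Act.card = ((range (m - 1)).powerset.filter (fun M : Finset ℕ => ∀ j ∈ M, j + 1 ∉ M)).card := by
    rw [← hActmap, Finset.card_map]
  have hsharp : Act.card ≤ ((pathDet a d b f m).roots.toFinset.filter fun x => 0 < x).card + 1 := by
    rw [hcardAct]; omega
  -- injectivity of the slope-sums on matchings (else the slope-sum row contradicts `hcon`)
  have hinj : ∀ M ∈ Act, ∀ M' ∈ Act, σ M = σ M' → M = M' := by
    intro M hM M' hM' h
    by_contra hMM'
    have hval : (M : Finset ℕ) ≠ (M' : Finset ℕ) := fun e => hMM' (Subtype.ext e)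
    have hMf : (M : Finset ℕ) ∈ (range (m - 1)).powerset.filter (fun M : Finset ℕ => ∀ j ∈ M, j + 1 ∉ M) :=
      Finset.mem_filter.mpr ⟨by rw [← hSdef]; exact M.2, (hmemAct M).mp hM⟩
    have hM'f : (M' : Finset ℕ) ∈ (range (m - 1)).powerset.filter (fun M : Finset ℕ => ∀ j ∈ M, j + 1 ∉ M) :=
      Finset.mem_filter.mpr ⟨by rw [← hSdef]; exact M'.2, (hmemAct M').mp hM'⟩
    have hzz : zs M = zs M' := by
      have : ((zs M : ℤ) : ℝ) = ((zs M' : ℤ) : ℝ) := by rw [← hσz M, ← hσz M']; exact h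
      exact_mod_cast this
    have := card_posRoots_add_two_le_of_coincidence a d b f m hMf hM'f hval hzz
    omega
  have hinjz : ∀ M ∈ Act, ∀ M' ∈ Act, z M = z M' → M = M' := fun M hM M' hM' h =>
    hinj M hM M' hM' (by rw [hσz, hσz, h])
  -- every matching slope-sum is divisible by `g`
  have hmodz : ∀ M ∈ Act, (g : ℤ) ∣ z M - 0 := by
    intro M _
    rw [sub_zero]
    refine Finset.dvd_sum fun j hj => hdiv j ?_
    have := Finset.mem_range.mp (Finset.mem_powerset.mp (by rw [← hSdef]; exact M.2) hj)
    omega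
  -- the face `(∅; k, l)`
  have hkl' : k ≠ l := by omega
  have me : (∅ : Finset ℕ) ∈ S := by rw [hSdef]; exact Finset.mem_powerset.mpr (Finset.empty_subset _)
  have mk : ({k} : Finset ℕ) ∈ S := by
    rw [hSdef, Finset.mem_powerset, Finset.singleton_subset_iff, Finset.mem_range]; omega
  have ml : ({l} : Finset ℕ) ∈ S := by
    rw [hSdef, Finset.mem_powerset, Finset.singleton_subset_iff, Finset.mem_range]; omega
  have mkl : ({k, l} : Finset ℕ) ∈ S := by
    rw [hSdef, Finset.mem_powerset, Finset.insert_subset_iff, Finset.singleton_subset_iff, Finset.mem_range, Finset.mem_range]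
    omega
  have Ae : (⟨∅, me⟩ : ↥S) ∈ Act := (hmemAct _).mpr (by simp)
  have Ak : (⟨{k}, mk⟩ : ↥S) ∈ Act := (hmemAct _).mpr (by simp)
  have Al : (⟨{l}, ml⟩ : ↥S) ∈ Act := (hmemAct _).mpr (by simp)
  have Akl : (⟨{k, l}, mkl⟩ : ↥S) ∈ Act := (hmemAct _).mpr (by
    intro j hj
    simp only [Finset.mem_insert, Finset.mem_singleton] at hj ⊢
    omega)
  -- integer values on the face
  set u : ℤ := 2 * (f k : ℤ) - d k - d (k + 1) with hu
  set v : ℤ := 2 * (f l : ℤ) - d l - d (l + 1) with hv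
  have ze : z ⟨∅, me⟩ = 0 := by simp [hz, hzs]
  have zk : z ⟨{k}, mk⟩ = u := by simp [hz, hzs, hu]
  have zl : z ⟨{l}, ml⟩ = v := by simp [hz, hzs, hv]
  have zkl : z ⟨{k, l}, mkl⟩ = u + v := by
    simp only [hz, hzs, hu, hv]
    rw [Finset.sum_pair hkl']
  -- coefficient moduli of the four face matchings
  set gq : ℕ → ℝ := fun j => b j ^ 2 / |a j * a (j + 1)| with hgq
  have pe : ∏ j ∈ (∅ : Finset ℕ), gq j = 1 := Finset.prod_empty
  have pk : ∏ j ∈ ({k} : Finset ℕ), gq j = gq k := Finset.prod_singleton _ _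
  have pl : ∏ j ∈ ({l} : Finset ℕ), gq j = gq l := Finset.prod_singleton _ _
  have pkl : ∏ j ∈ ({k, l} : Finset ℕ), gq j = gq k * gq l := Finset.prod_pair hkl'
  -- the core: a face whose values form a 4-term progression of step `g` on the lattice `gℤ` contradicts the face rule
  have hg' : (0 : ℤ) < g := by exact_mod_cast hg
  -- the occupied midpoint
  obtain ⟨M₀, hM₀, hM₀sum⟩ := hmid
  have mM₀ : M₀ ∈ S := by rw [hSdef]; exact (Finset.mem_filter.mp hM₀).1
  have AM₀ : (⟨M₀, mM₀⟩ : ↥S) ∈ Act := (hmemAct _).mpr (Finset.mem_filter.mp hM₀).2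
  have zM₀ : 2 * z ⟨M₀, mM₀⟩ = u + v := by simp only [hz, hzs, hu, hv]; exact hM₀sum
  have core : ∀ (E₁ M₁ M₂ E₂ : ↥S) (c : ℤ), E₁ ∈ Act → M₁ ∈ Act → M₂ ∈ Act → E₂ ∈ Act →
      z E₁ = c → z M₁ = c + g → z ⟨M₀, mM₀⟩ = c + 2 * g → z M₂ = c + 3 * g → z E₂ = c + 4 * g →
      (∏ j ∈ (E₁ : Finset ℕ), gq j) * (∏ j ∈ (E₂ : Finset ℕ), gq j) =
        (∏ j ∈ (M₁ : Finset ℕ), gq j) * (∏ j ∈ (M₂ : Finset ℕ), gq j) → False := by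
    intro E₁ M₁ M₂ E₂ c hE₁ hM₁ hM₂ hE₂ zE₁ zM₁ zP₀ zM₂ zE₂ hcoef
    have hgR : (0 : ℝ) < g := by exact_mod_cast hg
    have key := faceRule_of_sharp a d b f m ha hb σ rfl Act rfl hinj hsharp hE₁ hM₁ hM₂ hE₂
      (by rw [hσz, hσz, zE₁, zM₁]; push_cast; linarith)
      (by rw [hσz, hσz, zM₁, zM₂]; push_cast; linarith)
      (by rw [hσz, hσz, zM₂, zE₂]; push_cast; linarith)
      (by rw [hσz, hσz, hσz, hσz, zE₁, zM₁, zM₂, zE₂]; push_cast; ring)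
      hcoef
    simp_rw [hσz] at key
    have hmodc : ∀ Q ∈ Act, (g : ℤ) ∣ z Q - c := fun Q hQ => by
      have h1 := hmodz Q hQ
      have h2 := hmodz E₁ hE₁
      rw [sub_zero] at h1 h2
      rw [← zE₁]
      exact dvd_sub h1 h2
    exact absurd key (not_le.mpr
      (gapProduct_progression_one_three_mid Act z hinjz c g hg' hmodc hE₁ hM₁ AM₀ hM₂ hE₂ zE₁ zM₁ zP₀ zM₂ zE₂))
  -- the eight sign cases
  rcases h13 with ⟨hua, hva⟩ | ⟨hua, hva⟩
  · have hu2 : u = g ∨ u = -g := by omega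
    have hv2 : v = 3 * g ∨ v = -(3 * g) := by omega
    rcases hu2 with hu1 | hu1 <;> rcases hv2 with hv1 | hv1
    · exact core ⟨∅, me⟩ ⟨{k}, mk⟩ ⟨{l}, ml⟩ ⟨{k, l}, mkl⟩ 0 Ae Ak Al Akl
        (by omega) (by omega) (by omega) (by omega) (by omega) (by
          show (∏ j ∈ (∅ : Finset ℕ), gq j) * (∏ j ∈ ({k, l} : Finset ℕ), gq j) =
            (∏ j ∈ ({k} : Finset ℕ), gq j) * (∏ j ∈ ({l} : Finset ℕ), gq j)
          rw [pkl, pe, pk, pl]; ring)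
    · exact core ⟨{l}, ml⟩ ⟨{k, l}, mkl⟩ ⟨∅, me⟩ ⟨{k}, mk⟩ (-(3 * g)) Al Akl Ae Ak
        (by omega) (by omega) (by omega) (by omega) (by omega) (by
          show (∏ j ∈ ({l} : Finset ℕ), gq j) * (∏ j ∈ ({k} : Finset ℕ), gq j) =
            (∏ j ∈ ({k, l} : Finset ℕ), gq j) * (∏ j ∈ (∅ : Finset ℕ), gq j)
          rw [pkl, pe, pk, pl]; ring)
    · exact core ⟨{k}, mk⟩ ⟨∅, me⟩ ⟨{k, l}, mkl⟩ ⟨{l}, ml⟩ (-g) Ak Ae Akl Al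
        (by omega) (by omega) (by omega) (by omega) (by omega) (by
          show (∏ j ∈ ({k} : Finset ℕ), gq j) * (∏ j ∈ ({l} : Finset ℕ), gq j) =
            (∏ j ∈ (∅ : Finset ℕ), gq j) * (∏ j ∈ ({k, l} : Finset ℕ), gq j)
          rw [pkl, pe, pk, pl]; ring)
    · exact core ⟨{k, l}, mkl⟩ ⟨{l}, ml⟩ ⟨{k}, mk⟩ ⟨∅, me⟩ (-(4 * g)) Akl Al Ak Ae
        (by omega) (by omega) (by omega) (by omega) (by omega) (by
          show (∏ j ∈ ({k, l} : Finset ℕ), gq j) * (∏ j ∈ (∅ : Finset ℕ), gq j) =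
            (∏ j ∈ ({l} : Finset ℕ), gq j) * (∏ j ∈ ({k} : Finset ℕ), gq j)
          rw [pkl, pe, pk, pl]; ring)
  · have hu2 : u = 3 * g ∨ u = -(3 * g) := by omega
    have hv2 : v = g ∨ v = -g := by omega
    rcases hu2 with hu1 | hu1 <;> rcases hv2 with hv1 | hv1
    · exact core ⟨∅, me⟩ ⟨{l}, ml⟩ ⟨{k}, mk⟩ ⟨{k, l}, mkl⟩ 0 Ae Al Ak Akl
        (by omega) (by omega) (by omega) (by omega) (by omega) (by
          show (∏ j ∈ (∅ : Finset ℕ), gq j) * (∏ j ∈ ({k, l} : Finset ℕ), gq j) =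
            (∏ j ∈ ({l} : Finset ℕ), gq j) * (∏ j ∈ ({k} : Finset ℕ), gq j)
          rw [pkl, pe, pk, pl]; ring)
    · exact core ⟨{l}, ml⟩ ⟨∅, me⟩ ⟨{k, l}, mkl⟩ ⟨{k}, mk⟩ (-g) Al Ae Akl Ak
        (by omega) (by omega) (by omega) (by omega) (by omega) (by
          show (∏ j ∈ ({l} : Finset ℕ), gq j) * (∏ j ∈ ({k} : Finset ℕ), gq j) =
            (∏ j ∈ (∅ : Finset ℕ), gq j) * (∏ j ∈ ({k, l} : Finset ℕ), gq j)
          rw [pkl, pe, pk, pl]; ring)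
    · exact core ⟨{k}, mk⟩ ⟨{k, l}, mkl⟩ ⟨∅, me⟩ ⟨{l}, ml⟩ (-(3 * g)) Ak Akl Ae Al
        (by omega) (by omega) (by omega) (by omega) (by omega) (by
          show (∏ j ∈ ({k} : Finset ℕ), gq j) * (∏ j ∈ ({l} : Finset ℕ), gq j) =
            (∏ j ∈ ({k, l} : Finset ℕ), gq j) * (∏ j ∈ (∅ : Finset ℕ), gq j)
          rw [pkl, pe, pk, pl]; ring)
    · exact core ⟨{k, l}, mkl⟩ ⟨{k}, mk⟩ ⟨{l}, ml⟩ ⟨∅, me⟩ (-(4 * g)) Akl Ak Al Ae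
        (by omega) (by omega) (by omega) (by omega) (by omega) (by
          show (∏ j ∈ ({k, l} : Finset ℕ), gq j) * (∏ j ∈ (∅ : Finset ℕ), gq j) =
            (∏ j ∈ ({k} : Finset ℕ), gq j) * (∏ j ∈ ({l} : Finset ℕ), gq j)
          rw [pkl, pe, pk, pl]; ring)


/-- **THE RATIO-THREE FACE LAW (all sizes)** — primitive case `g = 1`. [this work] -/
theorem card_posRoots_add_two_le_card_matchings_of_slopes_one_three_mid (m k l : ℕ) (ha : ∀ j, a j ≠ 0) (hb : ∀ j, b j ≠ 0)
    (hkl : k + 2 ≤ l) (hlm : l + 2 ≤ m)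
    (h13 : ((2 * (f k : ℤ) - d k - d (k + 1)).natAbs = 1 ∧ (2 * (f l : ℤ) - d l - d (l + 1)).natAbs = 3) ∨
      ((2 * (f k : ℤ) - d k - d (k + 1)).natAbs = 3 ∧ (2 * (f l : ℤ) - d l - d (l + 1)).natAbs = 1))
    (hmid : ∃ M₀ ∈ (range (m - 1)).powerset.filter (fun M : Finset ℕ => ∀ j ∈ M, j + 1 ∉ M),
      2 * ∑ j ∈ M₀, (2 * (f j : ℤ) - d j - d (j + 1)) = (2 * (f k : ℤ) - d k - d (k + 1)) + (2 * (f l : ℤ) - d l - d (l + 1))) :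
    ((pathDet a d b f m).roots.toFinset.filter (fun x => 0 < x)).card + 2 ≤
      ((range (m - 1)).powerset.filter (fun M : Finset ℕ => ∀ j ∈ M, j + 1 ∉ M)).card :=
  card_posRoots_add_two_le_card_matchings_of_slopes_g_3g_mid a d b f m k l 1 ha hb le_rfl (fun j _ => one_dvd _) hkl hlm
    (by simpa using h13) hmid

/-- **m = 6**: such designs have `Z(D_6) ≤ 11`. [this work] -/
theorem card_posRoots_six_le_eleven_of_slopes_one_three_mid (k l : ℕ) (ha : ∀ j, a j ≠ 0) (hb : ∀ j, b j ≠ 0)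
    (hkl : k + 2 ≤ l) (hl : l ≤ 4)
    (h13 : ((2 * (f k : ℤ) - d k - d (k + 1)).natAbs = 1 ∧ (2 * (f l : ℤ) - d l - d (l + 1)).natAbs = 3) ∨
      ((2 * (f k : ℤ) - d k - d (k + 1)).natAbs = 3 ∧ (2 * (f l : ℤ) - d l - d (l + 1)).natAbs = 1))
    (hmid : ∃ M₀ ∈ (range (6 - 1)).powerset.filter (fun M : Finset ℕ => ∀ j ∈ M, j + 1 ∉ M),
      2 * ∑ j ∈ M₀, (2 * (f j : ℤ) - d j - d (j + 1)) = (2 * (f k : ℤ) - d k - d (k + 1)) + (2 * (f l : ℤ) - d l - d (l + 1))) :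
    ((pathDet a d b f 6).roots.toFinset.filter (fun x => 0 < x)).card ≤ 11 := by
  have h := card_posRoots_add_two_le_card_matchings_of_slopes_one_three_mid a d b f 6 k l ha hb hkl (by omega) h13 hmid
  have h13' : ((range (6 - 1)).powerset.filter (fun M : Finset ℕ => ∀ j ∈ M, j + 1 ∉ M)).card = 13 := by decide
  omega

end EdgeNormalForm

end Summit.ValiantsHypothesis.ValiantsHypothesis.Theorems.KPlusLogSqLaw
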